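import Literature.NumberTheory.DiophantineGeometry.AbelianVarietyOrdinaryReduction
import Literature.NumberTheory.FaltingsSerre.ParamodularBridge
import HarnessLib

/-!
# Ordinary reduction of an abelian surface read off the middle coefficient of its Euler factor
(Deligne's criterion)

Topic `NumberTheory/DiophantineGeometry`. ONE named fact (D-0014, `def … : Prop`, statement only)
and its proved one-directional corollary. It is the printed dictionary between the two meanings of
"ordinary at `p`" that meet in the tree:

* scheme-theoretic — `AbelianVariety.HasGoodOrdinaryReductionAt A v`
  (`DiophantineGeometry/AbelianVarietyOrdinaryReduction`): `A` has an abelian-scheme model at `v`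
  whose special fibre has exactly `p ^ dim A` geometric points of order dividing `p`
  (`p`-rank `= dim A`; Li–Oort §0.6); this is the hypothesis "good ordinary reduction at `3`" of
  Boxer–Calegari–Gee–Pilloni 2025, Thm. A (tree: `bcgp2025_modThreeSurjective_modular_abelianSurface`,
  clause (3a)), consumed by the certificate rows of `Summits/Ventures/ResidMod/`;
* Frobenius-theoretic — "`p ∤ b`", `b` the middle coefficient of the good Euler factor
  `L_p(A,T) = 1 − aT + bT² − paT³ + p²T⁴` (`AbelianVariety.HasGoodEulerFactorAt`,
  `Automorphic/Paramodular/Paramodularity`; `lPolynomialOfSurface`, `FaltingsSerre/ParamodularBridge`),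
  which is what a point count certifies.

## Sources (read 2026-08-22; page-level)

* E. W. Howe, *Principally polarized ordinary abelian varieties over finite fields*, Trans. AMS
  347 (1995) 2361–2401, printed p. 2366, **Definition (3.1)**, verbatim: "(see [3, §2]). Let `q` be
  a power of a prime number `p`, let `k` be a field with `q` elements, and let `k̄` be an algebraic
  closure of `k`. A `g`-dimensional abelian variety `A` over `k` is ordinary if the following
  equivalent conditions are satisfied: (a) `A` has exactly `p^g` points over `k̄` of order dividing
  `p`. (b) The connected component of the kernel of the multiplication-by-`p` map on `A` is of
  multiplicative type. (c) At least half of the roots of `h_A` in `Q̄_p`, counting multiplicities,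
  are `p`-adic units. (d) The middle coefficient of `h_A` is not divisible by `p`. (The middle
  coefficient of a polynomial in `X` of degree `2g` is the coefficient of `X^g`.)" — `h_A` the
  characteristic polynomial of Frobenius (§§2–3 ibid.). `[Howe1995OrdinaryAV]`
* [3] = P. Deligne, *Variétés abéliennes ordinaires sur un corps fini*, Invent. Math. 8 (1969)
  238–243, §2 (the PRIMARY source of the equivalence; Howe p. 2368 also cites "[3, Théorème
  (part d), pp. 240–241]"). Not held by the tree's library (acquisition acq-10035); cited through
  Howe's verbatim restatement. `[Deligne1969OrdinaryAV]`
* Second printed occurrence of (d) as the working definition: E. W. Howe, *Deducing information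
  about curves over finite fields from their Weil polynomials* (arXiv:2110.04221), §3.1: "A
  `g`-dimensional abelian variety over `F_q` is ordinary if the coefficient of `x^g` in its Weil
  polynomial is coprime to `q`."
* Transport to the generic fibre (why a statement about `A/ℚ` may quote a theorem about `Ā/𝔽_p`):
  for a place `v` of good reduction and `ℓ ≠ p`, `V_ℓ A` is unramified at `v` and
  `det(X − Frob_v | V_ℓ A) = det(X − π_Ā | T_ℓ Ā) = h_Ā(X)` — Shimura, *Abelian varieties with
  complex multiplication and modular functions* (1998), (19.4a) and Lemma 19.5; Serre–Tate, *Good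
  reduction of abelian varieties* (1968), §1 Thm. 1. In the tree this is the THEOREM
  `frobCharpoly_rationalTateGaloisRep_eq` / `exists_int_frobCharpoly_rationalTateGaloisRep_eq_map`
  of `Motives/AbelianVarietyGoodReductionFrobenius` (from its cited existence records
  `nonempty_goodReductionAt`, `nonempty_tateSpecialisation`), and `HasGoodEulerFactorAt A p L` SAYS
  that `X⁴ L(1/X) = X⁴ − aX³ + bX² − paX + p²` is that characteristic polynomial (arithmetic
  Frobenius on the covariant `V_ℓ A`, [BrumerEtAl2019, (4.1.5)]); so the middle coefficient of
  `h_Ā` is `b`. The good model in (a) may be taken to be any abelian-scheme model (uniqueness of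
  Néron models; Bosch–Lütkebohmert–Raynaud 1.2/8, Serre–Tate §1), as in the docstring of
  `HasGoodOrdinaryReductionAt`.

## Statement shape and what is NOT claimed

* Stated for abelian SURFACES over `ℚ` (`A.dim = 2`; the Euler-factor predicate of the tree is
  `ℚ`-based and `Fin 4`-framed) at a place `v ∣ p` of GOOD reduction (hypothesis
  `HasGoodReductionAt A.X A.dim v`, Serre–Tate §1; consumers holding only the Euler factor get it
  from the tree's Néron–Ogg–Šafarevič record `AbelianVariety.hasGoodReductionAt_of_isUnramifiedAt`).
  -- TODO(general form): Deligne's (a)⇔(d) for any abelian variety over any finite field `𝔽_q`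
  -- (`q = p^f`, middle coefficient of `h_A` prime to `p`), once the tree has a Frobenius
  -- characteristic polynomial attached to `AbelianVariety 𝔽_q` independent of a number field.
* The hypothesis `A.dim = 2` is essential: without it `HasGoodEulerFactorAt` (which quantifies
  over `Fin 4`-bases of `V_ℓ A`) is vacuous and the equivalence would be asserted for every `b`.
* Conditions (b), (c) of Deligne/Howe are not restated (no finite group schemes of multiplicative
  type / `p`-adic roots in the tree's vocabulary here).
* Mathlib: no abelian varieties; nothing here duplicates a Mathlib declaration.
-/

noncomputable section

open scoped NumberField Polynomial
open IsDedekindDomain Polynomial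
open Literature.AlgebraicGeometry.Motives (AbelianVariety)
open Literature.NumberTheory.FaltingsSerre (lPolynomialOfSurface)

namespace Literature.NumberTheory.DiophantineGeometry

/-- **Deligne's criterion: an abelian surface with good reduction at `p` has good ORDINARY
reduction at `p` iff `p` does not divide the middle coefficient of its Euler factor at `p`**
(Deligne, Invent. Math. 8 (1969), §2, as restated verbatim by Howe, Trans. AMS 347 (1995),
Def. (3.1), p. 2366: "A `g`-dimensional abelian variety `A` over `k` is ordinary if the following
equivalent conditions are satisfied: (a) `A` has exactly `p^g` points over `k̄` of order dividing
`p`. … (d) The middle coefficient of `h_A` is not divisible by `p`"; transported to `A/ℚ` by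
Shimura 1998 (19.4a) / Serre–Tate 1968 Thm. 1, see the module docstring). For an abelian surface
`A/ℚ` (`A.dim = 2`) whose good Euler factor at the prime `p` is
`L_p(A,T) = 1 − aT + bT² − paT³ + p²T⁴` (`HasGoodEulerFactorAt`, i.e. for every `ℓ ≠ p` the
arithmetic Frobenius at `p` on `V_ℓ A` is unramified with characteristic polynomial
`X⁴ − aX³ + bX² − paX + p²`), and every place `v ∣ p` at which `A` has good reduction: `A` has
good ordinary reduction at `v` (condition (a): the special fibre of an abelian-scheme model has
`p²` geometric points of order dividing `p`) if and only if `p ∤ b` (condition (d)). Named fact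
(D-0014); the cell `pub-residmod` reads its ORD(`p`) certificate (`p ∤ c₂`) through it.
[cite: Deligne1969OrdinaryAV, §2] [cite: Howe1995OrdinaryAV, Def. (3.1) (p. 2366)]
[cite: Shimura1998, (19.4a) and Lemma 19.5] -/
def deligne_hasGoodOrdinaryReductionAt_iff_not_dvd_middleCoeff : Prop :=
  ∀ (A : AbelianVariety ℚ) (p : ℕ) [Fact p.Prime] (a b : ℤ), A.dim = 2 →
    A.HasGoodEulerFactorAt p ((lPolynomialOfSurface p a b).map (Int.castRingHom ℚ)) →
      ∀ v : HeightOneSpectrum (𝓞 ℚ), ((p : ℕ) : 𝓞 ℚ) ∈ v.asIdeal →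
        Literature.AlgebraicGeometry.Motives.HasGoodReductionAt A.X A.dim v →
          (A.HasGoodOrdinaryReductionAt v ↔ ¬ (p : ℤ) ∣ b)

/-- **The direction a certificate uses**: good reduction at `v ∣ p`, Euler factor
`1 − aT + bT² − paT³ + p²T⁴` at `p`, and `p ∤ b` give good ordinary reduction at `v`
(Deligne 1969 §2 (d) ⇒ (a), via Howe 1995 Def. (3.1)). Immediate from the named fact, threaded as
the hypothesis `h` (D-0014). [cite: Howe1995OrdinaryAV, Def. (3.1) (p. 2366)] -/
theorem hasGoodOrdinaryReductionAt_of_not_dvd_middleCoeff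
    (h : deligne_hasGoodOrdinaryReductionAt_iff_not_dvd_middleCoeff)
    {A : AbelianVariety ℚ} {p : ℕ} [Fact p.Prime] {a b : ℤ} (hdim : A.dim = 2)
    (hL : A.HasGoodEulerFactorAt p ((lPolynomialOfSurface p a b).map (Int.castRingHom ℚ)))
    (hb : ¬ (p : ℤ) ∣ b) {v : HeightOneSpectrum (𝓞 ℚ)} (hv : ((p : ℕ) : 𝓞 ℚ) ∈ v.asIdeal)
    (hgood : Literature.AlgebraicGeometry.Motives.HasGoodReductionAt A.X A.dim v) :
    A.HasGoodOrdinaryReductionAt v :=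
  (h A p a b hdim hL v hv hgood).mpr hb

/-- **The converse direction**: good ordinary reduction at `v ∣ p` forces `p ∤ b` (Deligne 1969
§2 (a) ⇒ (d); also the sentence of Boxer–Calegari–Gee–Pilloni 2025, §9.2 before Table 9.2.3:
"If `A/Q₂` has good ordinary reduction, then certainly the characteristic polynomial `Q(x)` of
Frobenius at `2` will (by the Weil conjectures) be an ordinary Weil polynomial", i.e. `(b, p) = 1`).
Immediate from the named fact. [cite: Howe1995OrdinaryAV, Def. (3.1) (p. 2366)] -/
theorem not_dvd_middleCoeff_of_hasGoodOrdinaryReductionAt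
    (h : deligne_hasGoodOrdinaryReductionAt_iff_not_dvd_middleCoeff)
    {A : AbelianVariety ℚ} {p : ℕ} [Fact p.Prime] {a b : ℤ} (hdim : A.dim = 2)
    (hL : A.HasGoodEulerFactorAt p ((lPolynomialOfSurface p a b).map (Int.castRingHom ℚ)))
    {v : HeightOneSpectrum (𝓞 ℚ)} (hv : ((p : ℕ) : 𝓞 ℚ) ∈ v.asIdeal)
    (hord : A.HasGoodOrdinaryReductionAt v) : ¬ (p : ℤ) ∣ b :=
  (h A p a b hdim hL v hv hord.hasGoodReductionAt).mp hord

-- The identity `(lPolynomialOfSurface p a b).coeff 2 = b` (so that "`p ∤ b`" above is literally Howe's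
-- condition (d) on `h_Ā = X⁴ L(1/X)`) is the tree's
-- `Literature.NumberTheory.FaltingsSerre.coeff_lPolynomialOfSurface_two` (`FaltingsSerre/ResidualFrobeniusData`).

end Literature.NumberTheory.DiophantineGeometry

end
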